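import Mathlib
import HarnessLib
import Summits.HubbardSuperconductivity.HubbardSuperconductivity.Theorems.KLProgrammeKLRegimeSplitEngineV4
import Summits.HubbardSuperconductivity.HubbardSuperconductivity.Theorems.KLProgrammeKLRegimeSplitTwoLegF

/-!
# Route `KLProgramme` — crux K3 `KLRegimeTwoPointLimit` (stmt-HubbardSuperconductivity-19937): the predicate bundle VERSION 5 =
# THE ONE BUNDLE OF RECORD of the director's ruling 2026-08-26T12:08:36Z / 12:18:20Z (c) and plan g9 12:17:40Z:
# `klPredsV5 := { klPredsV3 with engine := EngineBoundsAtV4, renorm := RenormalisedAtF, twoLeg := TwoLegStepV5 }` (seat p2, g4)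

V5 vs the landed `klPredsV4` (`…SplitPredicatesV4`, p445352, filed by this seat BEFORE it had read the ruling): V4 kept p1's V3 ENGINE slot
`EngineBoundsAtV3`; the ruling's engine slot of record is p1's `EngineBoundsAtV4` (`…SplitEngineV4`, p444106: V3 + the thermal-layer term
(T) `thermalBar` and the one-particle-reducible leg-dressing term (D) `legDressBar·legSliceCount` in the value-increment and ladder
clauses, `KernelNormsV4`).  V5 = V4 with `engine := EngineBoundsAtV4` AND the comparison-frame history of the two-leg Lipschitz clause
read at `EngineBoundsAtV4` (`histV5`; with `histV4`'s V3 engine, child 2 could not discharge (E3c)'s hypothesis for frames carrying the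
V4-engine history — the two must agree).  `klPredsV4` is SUPERSEDED (nothing binds it).

The three p2 repairs it carries (HOME/STATUS p2 g4 12:06Z; HOME/P2-C4B.md §9): Δ8 — children RESTAGED with `R` before `Q`
(`EngineP2`/`CountertermP2`, `…SplitGenericV2`); Δ9 — `renorm := RenormalisedAtF` (local part ON THE FRAME'S FERMI CURVE within the
QUADRATIC tolerance `cr|U|Λ_n²/e₀`, no field-strength clause; `z` is the engine output (E3d) in `TwoLegSlopes`); Δ10 — `twoLeg :=
TwoLegStepV5` = (E3a–c) on the Fermi-curve-read pieces `klTwoLegPieceF` (`…SplitTwoLegF`, BGM's `ℒ`) + (E3d/e) `TwoLegSlopes`, Lipschitz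
history `histV5`, with the sizes clause TWO-TIER (Δ11, `TwoLegSizesF2` below: orders `≤ 2` for every admissible frame, orders `≤ 4` for
frames without structure finer than `n` — the frame's own curve carries its fine wiggles into `∂_θʲ` of the reading for `j ≥ 3`).  `split := BetaSplitAtV3` (p1, V3) verbatim.  Children of record: `EngineP2 | BetaSplitP | CountertermP2 |
TwoPointAssemblyP klPredsV5 klWindowC`; glue-by `KLRegimeInductionV5 := KLRegimeInductionP2 klPredsV5` (`…SplitGlueV5`).

SUPPLIER MAP, p2 slots (consumer ⇐ suppliers; owner) — V3/V4 engine+split rows as in `…SplitPredicatesV3` / `…SplitEngineV4` docs: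
| `RenormalisedAtF n` (every `n ≤ n_β`, child 2's ONE frame)   | fixed point of `T(K) = P(K) ⊖ D_N(K)`: (E3a-F) sizes Σ_n ⇒ self-map (`frameOK_counterterm`-type), (E3c-F) Σ_n `lipBar` ≤ ½ ⇒ contraction, tail Σ_{j>n} `twoLegBar 0 j` ⇒ quadratic tolerance | child 2 (p2) |
| (E3a-F)(E3b-F)(E3c-F) at `n`                                  | tree expansion of the scale-`n` step read through BGM's `ℒ` (local part on the curve; App. C floor); at `n = 0` incl. the aliasing `symInterp(K|_L) − K` of the admissible frame at the curve, `≤ C·R.Gfr 4·U²·16^{n_β}/L²`, inside the slack for `L ≥ L₃(β,U)` (chosen after `R`) | child 3 (engine)      |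
| (E3d/e) `TwoLegSlopes n`                                       | second-order two-leg computations of the engine (`z − 1`, `∂_e Re Σ = O(U²)`), any `cz > 0` for `U ≤ U₀(R)` | child 3 (engine)      |
| engine's residual-mass inputs at `n` (two-leg vertex of `V_{n-1}` small on the slice) | `HistP`: `RenormalisedAtF (j<n)` + `TwoLegSlopes (j<n)` | child 3 hypothesis |
Definitions only; nothing is asserted about the model.
-/

noncomputable section

namespace Summit.HubbardSuperconductivity.HubbardSuperconductivity.Theorems.KLRegimeSplit

set_option linter.dupNamespace false -- summit = problem name (single-conjunct summit), D-0017

open Real Finset Literature.MathematicalPhysics.QuantumLattice Literature.Probability.LatticeModels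
open Summit.HubbardSuperconductivity.HubbardSuperconductivity.Theorems.KLProgrammeLegKernels

/-! ## §1 The V5 two-leg slot: `TwoLegStepF` at this bundle's history -/

section Model

variable (L M : ℕ) [NeZero L] [NeZero M]

/-- **(E3a-F2) the sizes of the scale-`n` piece, TWO-TIER** (self-audit Δ11 = KT-S2 at the reading point): orders `j ≤ 2` for EVERY
admissible frame, and orders `j ≤ 4` for frames WITHOUT STRUCTURE FINER THAN `n` (`FrameOK R U n μ K`: an admissible decomposition into
pieces of scales `≤ n` — exactly child 2's stage-`n` iterates, and BGM's `E_h`, which has no increments below `h`).  Reason: the local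
part is read on the frame's OWN Fermi curve, whose `θ`-derivatives of order `j ≥ 3` are those of the frame (`≍ ‖D³K‖`, uncapped by
`GeomConstants`; `≍ R.Gfr 3·U²·4^{N}` for a frame with pieces down to `N = n_β`); through the increment's normal slope `≍ U²Λ_n` they
enter `∂_θʲ ℓ_n`, exceeding `twoLegBar j n ∝ 4^{(j-2)n}` by `4^{(j-2)(N-n)}`.  Orders `≤ 2` are capped by `GeomConstants` (`‖D²e_K‖ ≤ 7`)
and fit the majorants absolutely. -/
def TwoLegSizesF2 (G : GeoConsts) (Q : EngConsts) (R : RenConsts) (β U μ : ℝ) (K : TrigPolyC4v) (n : ℕ) : Prop :=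
  (∀ j ≤ 2, ∀ q : Momentum,
      ‖iteratedFDeriv ℝ j (evalM (klTwoLegPieceF L M β U μ K n)) q‖ ≤ twoLegBar G Q U j n) ∧
  (FrameOK R U n μ K → ∀ j ≤ 4, ∀ q : Momentum,
      ‖iteratedFDeriv ℝ j (evalM (klTwoLegPieceF L M β U μ K n)) q‖ ≤ twoLegBar G Q U j n)

/-- **`TwoLegStepF2 hist G P Q R … K n`** = (E3a-F2) two-tier sizes ∧ (E3b-F) floor ∧ (E3c-F) frame-Lipschitz (history `hist`) ∧ (E3d/e)
slopes — `TwoLegStepF` with the sizes clause replaced by `TwoLegSizesF2`. -/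
def TwoLegStepF2 (hist : TrigPolyC4v → ℕ → Prop) (G : GeoConsts) (_P : SplitConsts) (Q : EngConsts) (R : RenConsts)
    (β U μ : ℝ) (K : TrigPolyC4v) (n : ℕ) : Prop :=
  TwoLegSizesF2 L M G Q R β U μ K n ∧ TwoLegFloorF L M G Q β U μ K n ∧
    FrameLipschitzF L M hist G Q R β U μ K n ∧ TwoLegSlopes L M R β U μ K n

/-- **The comparison-frame history of the V5 bundle** at scale `j` (what (E3c-F)'s `K′` is assumed to satisfy below `n`): V3's split,
the v2 renormalisation and the V4 engine output — `BetaSplitAtV3 ∧ RenormalisedAtF ∧ EngineBoundsAtV4` at `j` (= this bundle's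
`split ∧ renorm ∧ engine`, so `HistP klPredsV5 … n` discharges it: `histV5_of_histP`). -/
def histV5 (G : GeoConsts) (P : SplitConsts) (Q : EngConsts) (R : RenConsts) (β U μ : ℝ) : TrigPolyC4v → ℕ → Prop :=
  fun K' j => BetaSplitAtV3 L M G P Q β U μ K' j ∧ RenormalisedAtF L M β U μ K' R j ∧ EngineBoundsAtV4 L M G P Q β U μ K' j

/-- **`TwoLegStepV5 … G P Q R K n`** := `TwoLegStepF2` ((E3a-F2) two-tier sizes ∧ (E3b-F) floor ∧ (E3c-F) frame-Lipschitz ∧ (E3d/e) slopes,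
on the Fermi-curve-read pieces) with the comparison-frame history `histV5`.  Same slot type as `Preds.twoLeg`. -/
def TwoLegStepV5 (G : GeoConsts) (P : SplitConsts) (Q : EngConsts) (R : RenConsts) (β U μ : ℝ) (K : TrigPolyC4v) (n : ℕ) :
    Prop :=
  TwoLegStepF2 L M (histV5 L M G P Q R β U μ) G P Q R β U μ K n

end Model

/-! ## §2 The V5 bundle -/

/-- **`klPredsV5 : Preds`** := `{ frameOK := FrameOK, renorm := RenormalisedAtF, split := BetaSplitAtV3, engine := EngineBoundsAtV4,
twoLeg := TwoLegStepV5 }` — the ONE bundle of record (V3 split, V4 engine, p2's renorm/twoLeg v2: Δ9/Δ10).  Children of record (restaged, Δ8):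
`EngineP2 klPredsV5 klWindowC`, `BetaSplitP klPredsV5 klWindowC`, `CountertermP2 klPredsV5 klWindowC`,
`TwoPointAssemblyP klPredsV5 klWindowC` (`…SplitGenericV2`); glue line (downstream, `…SplitGlueV5`):
`KLRegimeInductionV5 := KLRegimeInductionP2 klPredsV5`. -/
def klPredsV5 : Preds where
  frameOK := FrameOK
  renorm := fun L M _ _ β U μ K R n => RenormalisedAtF L M β U μ K R n
  split := fun L M _ _ G P Q β U μ K n => BetaSplitAtV3 L M G P Q β U μ K n
  engine := fun L M _ _ G P Q β U μ K n => EngineBoundsAtV4 L M G P Q β U μ K n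
  twoLeg := fun L M _ _ G P Q R β U μ K n => TwoLegStepV5 L M G P Q R β U μ K n

/-! ## §3 Bookkeeping (`rfl`-level) -/

/-- V5's split slot IS V3's. -/
theorem klPredsV5_split : klPredsV5.split = klPredsV3.split := rfl

/-- V5's engine slot is p1's `EngineBoundsAtV4`. -/
theorem klPredsV5_engine (L M : ℕ) [NeZero L] [NeZero M] (G : GeoConsts) (P : SplitConsts) (Q : EngConsts) (β U μ : ℝ)
    (K : TrigPolyC4v) (n : ℕ) : klPredsV5.engine L M G P Q β U μ K n = EngineBoundsAtV4 L M G P Q β U μ K n := rfl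

/-- V5's frame class IS V3's (`FrameOK`). -/
theorem klPredsV5_frameOK : klPredsV5.frameOK = klPredsV3.frameOK := rfl

/-- V5's renormalisation slot is `RenormalisedAtF`. -/
theorem klPredsV5_renorm (L M : ℕ) [NeZero L] [NeZero M] (β U μ : ℝ) (K : TrigPolyC4v) (R : RenConsts) (n : ℕ) :
    klPredsV5.renorm L M β U μ K R n = RenormalisedAtF L M β U μ K R n := rfl

/-- V5's two-leg slot is `TwoLegStepV5`. -/
theorem klPredsV5_twoLeg (L M : ℕ) [NeZero L] [NeZero M] (G : GeoConsts) (P : SplitConsts) (Q : EngConsts) (R : RenConsts)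
    (β U μ : ℝ) (K : TrigPolyC4v) (n : ℕ) :
    klPredsV5.twoLeg L M G P Q R β U μ K n = TwoLegStepV5 L M G P Q R β U μ K n := rfl

/-- **`FrameOK` is monotone in the number of scales**: an admissible decomposition into pieces of scales `≤ n` is one into pieces of
scales `≤ N` for `n ≤ N` (zero pieces beyond `n`; needs `0 ≤ R.Gfr j`, part of `R.WF`).  So child 2's stage-`n` frames, admissible at depth
`n`, are admissible at the full depth `nScales β` at which the children quantify, and (E3a-F2)'s second tier applies to them. -/
theorem FrameOK.mono {R : RenConsts} (hR : ∀ j, 0 ≤ R.Gfr j) {U : ℝ} {n N : ℕ} (hnN : n ≤ N) {μ : ℝ} {K : TrigPolyC4v}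
    (h : FrameOK R U n μ K) : FrameOK R U N μ K := by
  obtain ⟨hgeom, Kp, hsum, hbd⟩ := h
  refine ⟨hgeom, fun m => if m ≤ n then Kp m else 0, ?_, ?_⟩
  · intro p
    rw [hsum p, ← Finset.sum_range_add_sum_Ico _ (Nat.succ_le_succ hnN)]
    have hzero : ∑ m ∈ Finset.Ico (n + 1) (N + 1), (if m ≤ n then Kp m else 0).eval p = 0 := by
      refine Finset.sum_eq_zero fun m hm => ?_
      have hm' : ¬ m ≤ n := by
        have := (Finset.mem_Ico.mp hm).1
        omega
      simp [hm']
    rw [hzero, add_zero]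
    refine Finset.sum_congr rfl fun m hm => ?_
    have hm' : m ≤ n := Nat.lt_succ_iff.mp (Finset.mem_range.mp hm)
    simp [hm']
  · intro m hm j hj q
    by_cases hmn : m ≤ n
    · simp only [hmn, if_true]
      exact hbd m hmn j hj q
    · simp only [hmn]
      have h0 : evalM (0 : TrigPolyC4v) = fun _ => (0 : ℝ) := by
        funext x; simp [evalM]
      rw [if_false, h0, iteratedFDeriv_fun_zero]
      simp only [Pi.zero_apply, norm_zero]
      exact mul_nonneg (mul_nonneg (hR j) (uPow_nonneg j U)) (zpow_nonneg (by norm_num) _)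

/-- The V5 history at `j` IS the three V5 slots at `j`: `HistP klPredsV5 … n` gives `histV5 … K j` for every `j < n` (child 2 can
discharge (E3c-F)'s hypothesis for the frames it compares). -/
theorem histV5_of_histP {L M : ℕ} [NeZero L] [NeZero M] {G : GeoConsts} {P : SplitConsts} {Q : EngConsts} {R : RenConsts}
    {β U μ : ℝ} {K : TrigPolyC4v} {n : ℕ} (h : HistP klPredsV5 L M G P Q R β U μ K n) :
    ∀ j < n, histV5 L M G P Q R β U μ K j := fun j hj =>
  ⟨(h j hj).1, (h j hj).2.1, (h j hj).2.2.1⟩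

end Summit.HubbardSuperconductivity.HubbardSuperconductivity.Theorems.KLRegimeSplit

end
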